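import Summits.Ventures.PercRepro.S1TriangleCountSharp

/-!
# PercRepro — THE BOOTSTRAPPED TRIANGLE COUNT AT BOUNDED NULLITY: `s₃ ≤ triBound ν` under (C1) (p8, gen 21; a feeder
for S4 — the top of the `q = 7` window, the row `53`)

The deletion inductions of LEMMA T, the sharp and the sharper triangle counts (S1TriangleCount, S1TriangleCountSharp,
S1TriangleCountSharperB) pay `t_e ≤ ν`, `ν − 1`, `ν − 2` for the triangles through the deleted point `e`. Here the deleted
point is the point `x` ON THE FEWEST TRIANGLES, `m := t_x`, and the price is bounded by the count itself: every point of
`U := ⋃ triangles` lies on `≥ m` triangles and `U` has `≥ 1 + 2m` points (the star of `x`: two triangles through `x` meet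
only in `x` under (C1), `ThmN.eRk_le_and_ncard_eq_of_triangles`), so the double count gives `m(2m + 1) ≤ |U|·m ≤ 3·s₃`
(`ncard_sUnion_mul_le_three_mul_ncard_triangles`); with `s₃ ≤ m + s₃(M ＼ {x})` (the triangles avoiding `x` are those of
`M ＼ {x}`, nullity `ν − 1`) this forces `2m(m − 1) ≤ 3·s₃(M ＼ {x})`. Hence
**`s₃ ≤ triBound ν`**, `triBound 0 = 0`, `triBound (ν + 1) = triBound ν + tmax (triBound ν)`,
`tmax x = max {t : 2t(t − 1) ≤ 3x}` (`ncard_triangles_le_triBound`): `0, 1, 2, 4, 7, 10, 14, 19, 24, 30, 37, 44, 52, 61, 71, …`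
— against the sharper count `(ν² − 3ν + 12)/2`: `61` against `71` at `ν = 13`, `393` against `501` at `ν = 33`
(asymptotically `(7/16)ν²` against `ν²/2`). The values at the coranks of a row are evaluated step by step
(`triBound_succ_eq`, S1TriangleCountBootValues). Axioms: standard.
-/

open scoped Matroid

namespace PercRepro

namespace S1

open Set

variable {α : Type}

/-- **The increment of the bootstrap**: the largest `t` with `2t(t − 1) ≤ 3x` (stated as `2t² ≤ 2t + 3x`). -/
def tmax (x : ℕ) : ℕ := Nat.findGreatest (fun t => 2 * t * t ≤ 2 * t + 3 * x) (x + 1)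

/-- **The bootstrapped triangle bound**: `triBound 0 = 0`, `triBound (ν + 1) = triBound ν + tmax (triBound ν)`. -/
def triBound : ℕ → ℕ
  | 0 => 0
  | d + 1 => triBound d + tmax (triBound d)

/-- The recursion of `triBound`. -/
theorem triBound_succ (d : ℕ) : triBound (d + 1) = triBound d + tmax (triBound d) := rfl

/-- A `t` with `2t² ≤ 2t + 3x` is at most `tmax x`. -/
theorem le_tmax_of_le {x t : ℕ} (h : 2 * t * t ≤ 2 * t + 3 * x) : t ≤ tmax x := by
  unfold tmax
  refine Nat.le_findGreatest (P := fun t => 2 * t * t ≤ 2 * t + 3 * x) ?_ h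
  by_contra hlt
  have hlt' : x + 1 < t := Nat.lt_of_not_le hlt
  nlinarith [h, hlt']

/-- **The step of the values**: if `triBound d = F`, `2t² ≤ 2t + 3F` and `2(t+1)² > 2(t+1) + 3F`, then
`triBound (d + 1) = F + t`. -/
theorem triBound_succ_eq {d F t : ℕ} (hF : triBound d = F) (h1 : 2 * t * t ≤ 2 * t + 3 * F)
    (h2 : 2 * (t + 1) + 3 * F < 2 * (t + 1) * (t + 1)) : triBound (d + 1) = F + t := by
  rw [triBound_succ, hF]
  congr 1
  unfold tmax
  rw [Nat.findGreatest_eq_iff]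
  refine ⟨?_, fun _ => h1, fun n _ hn hP => ?_⟩
  · by_contra hlt
    have hlt' : F + 1 < t := Nat.lt_of_not_le hlt
    nlinarith [h1, hlt']
  · have hmono : 2 * (t + 1) * (t + 1) ≤ 2 * (t + 1) + 3 * F := by nlinarith [hP, hn]
    omega

/-- **The double count, lower direction**: if every point of `U = ⋃ triangles` lies on at least `m` triangles, then
`|U|·m ≤ 3·s₃`. -/
theorem ncard_sUnion_mul_le_three_mul_ncard_triangles (M : Matroid α) [M.Finite] {m : ℕ}
    (hm : ∀ x ∈ ⋃₀ ThmN.triangles M, m ≤ (ThmN.trianglesThrough M x).ncard) :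
    (⋃₀ ThmN.triangles M).ncard * m ≤ 3 * (ThmN.triangles M).ncard := by
  classical
  have hTfin : (ThmN.triangles M).Finite :=
    M.ground_finite.finite_subsets.subset (fun C hC => hC.1.subset_ground)
  have hUE : ⋃₀ ThmN.triangles M ⊆ M.E := by
    intro z hz
    obtain ⟨C, hC, hzC⟩ := Set.mem_sUnion.1 hz
    exact hC.1.subset_ground hzC
  have hUfin : (⋃₀ ThmN.triangles M).Finite := M.ground_finite.subset hUE
  set Tf : Finset (Set α) := hTfin.toFinset with hTf
  set Uf : Finset α := hUfin.toFinset with hUf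
  have hmemT : ∀ C, C ∈ Tf ↔ C ∈ ThmN.triangles M := fun C => Set.Finite.mem_toFinset hTfin
  have hmemU : ∀ x, x ∈ Uf ↔ x ∈ ⋃₀ ThmN.triangles M := fun x => Set.Finite.mem_toFinset hUfin
  have hswap : ∑ x ∈ Uf, ∑ C ∈ Tf, (if x ∈ C then 1 else 0) =
      ∑ C ∈ Tf, ∑ x ∈ Uf, (if x ∈ C then 1 else 0) := Finset.sum_comm
  have hrow : ∀ C ∈ Tf, ∑ x ∈ Uf, (if x ∈ C then 1 else 0) = 3 := by
    intro C hC
    rw [Finset.sum_boole, Nat.cast_id]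
    have hCT : C ∈ ThmN.triangles M := (hmemT C).1 hC
    have hCfin : C.Finite := M.ground_finite.subset hCT.1.subset_ground
    have hfilter : (Uf.filter (fun x => x ∈ C)) = hCfin.toFinset := by
      ext x
      simp only [Finset.mem_filter, Set.Finite.mem_toFinset]
      constructor
      · rintro ⟨-, hx⟩; exact hx
      · intro hx
        exact ⟨(hmemU x).2 (Set.mem_sUnion.2 ⟨C, hCT, hx⟩), hx⟩
    rw [hfilter, ← Set.ncard_eq_toFinset_card C hCfin, hCT.2]
  have hcol : ∀ x ∈ Uf, m ≤ ∑ C ∈ Tf, (if x ∈ C then 1 else 0) := by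
    intro x hx
    rw [Finset.sum_boole, Nat.cast_id]
    have hxU : x ∈ ⋃₀ ThmN.triangles M := (hmemU x).1 hx
    have hfilter : ((Tf.filter (fun C => x ∈ C)) : Set (Set α)) = ThmN.trianglesThrough M x := by
      ext C
      simp only [Finset.coe_filter, Set.mem_setOf_eq, hmemT, ThmN.triangles, ThmN.trianglesThrough]
      tauto
    have hcard : (Tf.filter (fun C => x ∈ C)).card = (ThmN.trianglesThrough M x).ncard := by
      rw [← hfilter, Set.ncard_coe_finset]
    rw [hcard]
    exact hm x hxU
  have hleft : ∑ C ∈ Tf, ∑ x ∈ Uf, (if x ∈ C then 1 else 0) = 3 * (ThmN.triangles M).ncard := by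
    rw [Finset.sum_congr rfl hrow, Finset.sum_const, smul_eq_mul, hTf, ← Set.ncard_eq_toFinset_card _ hTfin,
      mul_comm]
  have hright : (⋃₀ ThmN.triangles M).ncard * m ≤ ∑ x ∈ Uf, ∑ C ∈ Tf, (if x ∈ C then 1 else 0) := by
    calc (⋃₀ ThmN.triangles M).ncard * m = ∑ _x ∈ Uf, m := by
          rw [Finset.sum_const, smul_eq_mul, hUf, ← Set.ncard_eq_toFinset_card _ hUfin]
      _ ≤ ∑ x ∈ Uf, ∑ C ∈ Tf, (if x ∈ C then 1 else 0) := Finset.sum_le_sum hcol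
  rw [← hleft, ← hswap]
  exact hright

/-- **The star of a point of a triangle has `1 + 2t_x` points inside `⋃ triangles`** (under (C1)). -/
theorem one_add_two_mul_ncard_trianglesThrough_le (M : Matroid α) [M.Finite]
    (hC1 : ∀ L ⊆ M.E, M.eRk L = 2 → L.ncard ≤ 3) {x : α} (hx : M.IsNonloop x)
    (hxU : x ∈ ⋃₀ ThmN.triangles M) :
    1 + 2 * (ThmN.trianglesThrough M x).ncard ≤ (⋃₀ ThmN.triangles M).ncard := by
  classical
  have hTfin : (ThmN.trianglesThrough M x).Finite :=
    M.ground_finite.finite_subsets.subset (fun C hC => hC.1.subset_ground)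
  set s := hTfin.toFinset with hsdef
  have hs : ∀ C ∈ s, C ∈ ThmN.trianglesThrough M x := fun C hC => (Set.Finite.mem_toFinset hTfin).1 hC
  have hscard : s.card = (ThmN.trianglesThrough M x).ncard := by
    rw [hsdef, ← Set.ncard_eq_toFinset_card _ hTfin]
  obtain ⟨-, hc⟩ := ThmN.eRk_le_and_ncard_eq_of_triangles M hC1 hx s hs
  have hUE : ⋃₀ ThmN.triangles M ⊆ M.E := by
    intro z hz
    obtain ⟨C, hC, hzC⟩ := Set.mem_sUnion.1 hz
    exact hC.1.subset_ground hzC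
  have hUfin : (⋃₀ ThmN.triangles M).Finite := M.ground_finite.subset hUE
  have hsub : ({x} ∪ ⋃ C ∈ s, C) ⊆ ⋃₀ ThmN.triangles M := by
    intro z hz
    rcases hz with hz | hz
    · rw [Set.mem_singleton_iff.1 hz]; exact hxU
    · obtain ⟨C, hC, hzC⟩ := Set.mem_iUnion₂.1 hz
      exact Set.mem_sUnion.2 ⟨C, ⟨(hs C hC).1, (hs C hC).2.1⟩, hzC⟩
  have h2 : ({x} ∪ ⋃ C ∈ s, C).ncard ≤ (⋃₀ ThmN.triangles M).ncard := Set.ncard_le_ncard hsub hUfin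
  rw [← hscard]
  omega

/-- **THE BOOTSTRAPPED TRIANGLE COUNT.** If `|E| = r(E) + d` and every rank-`2` set has at most `3` elements, then
`#(triangles M) ≤ triBound d`. Deletion induction on `|E|` at the point `x` on the fewest triangles (`m := t_x`): the
triangles avoiding `x` are those of `M ＼ {x}` (nullity `d − 1`), so `s₃ ≤ m + triBound (d − 1)`; the double count on
`U = ⋃ triangles` (every point on `≥ m` triangles, `|U| ≥ 1 + 2m`) gives `m(2m + 1) ≤ 3·s₃`; together
`2m(m − 1) ≤ 3·triBound (d − 1)`, i.e. `m ≤ tmax (triBound (d − 1))`. -/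
theorem ncard_triangles_le_triBound (M : Matroid α) [M.Finite]
    (hC1 : ∀ L ⊆ M.E, M.eRk L = 2 → L.ncard ≤ 3) {d : ℕ} (hd : M.E.encard = M.eRank + d) :
    (ThmN.triangles M).ncard ≤ triBound d := by
  suffices H : ∀ n : ℕ, ∀ (M : Matroid α) [M.Finite], M.E.ncard = n →
      (∀ L ⊆ M.E, M.eRk L = 2 → L.ncard ≤ 3) → ∀ d : ℕ, M.E.encard = M.eRank + d →
      (ThmN.triangles M).ncard ≤ triBound d from H _ M rfl hC1 d hd
  intro n
  induction n using Nat.strong_induction_on with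
  | _ n ih =>
  intro M _ hn hC1 d hd
  classical
  set S := ThmN.triangles M with hS
  have hSfin : S.Finite :=
    M.ground_finite.finite_subsets.subset (fun C hC => hC.1.subset_ground)
  by_cases hSe : S = ∅
  · rw [hSe, ncard_empty]; exact Nat.zero_le _
  -- the point on the fewest triangles
  have hUE : ⋃₀ S ⊆ M.E := by
    intro z hz
    obtain ⟨C, hC, hzC⟩ := Set.mem_sUnion.1 hz
    exact hC.1.subset_ground hzC
  have hUfin : (⋃₀ S).Finite := M.ground_finite.subset hUE
  set Uf : Finset α := hUfin.toFinset with hUf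
  have hmemU : ∀ x, x ∈ Uf ↔ x ∈ ⋃₀ S := fun x => Set.Finite.mem_toFinset hUfin
  have hUne : Uf.Nonempty := by
    obtain ⟨C₀, hC₀⟩ := nonempty_iff_ne_empty.2 hSe
    obtain ⟨e, heC₀⟩ := hC₀.1.nonempty
    exact ⟨e, (hmemU e).2 (Set.mem_sUnion.2 ⟨C₀, hC₀, heC₀⟩)⟩
  obtain ⟨x, hxU, hxmin⟩ := Finset.exists_min_image Uf (fun y => (ThmN.trianglesThrough M y).ncard) hUne
  have hxU' : x ∈ ⋃₀ S := (hmemU x).1 hxU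
  obtain ⟨C₀, hC₀, hxC₀⟩ := Set.mem_sUnion.1 hxU'
  set m := (ThmN.trianglesThrough M x).ncard with hm
  have hmin : ∀ y ∈ ⋃₀ ThmN.triangles M, m ≤ (ThmN.trianglesThrough M y).ncard :=
    fun y hy => hxmin y ((hmemU y).2 hy)
  have heE : x ∈ M.E := hC₀.1.subset_ground hxC₀
  have hne : ¬ M.IsColoop x := hC₀.1.not_isColoop_of_mem hxC₀
  have hx : M.IsNonloop x := by
    refine _root_.Matroid.isNonloop_of_not_isLoop heE ?_
    intro hloop
    have hC₀e : C₀ = {x} := hloop.eq_of_isCircuit_mem hC₀.1 hxC₀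
    have := hC₀.2
    rw [hC₀e, ncard_singleton] at this
    omega
  -- the nullity of `M ＼ {x}` is `d − 1`
  have hν : M✶.eRank = (d : ℕ∞) := by
    have h := _root_.Matroid.eRank_add_eRank_dual M
    rw [hd] at h
    exact WithTop.add_left_cancel (PercRepro.Matroid.eRank_ne_top_of_finite M) h
  have hdel := PercRepro.Matroid.dual_eRank_delete_singleton_add_one heE hne
  rw [hν] at hdel
  have hfin' : (M ＼ {x})✶.eRank ≠ ⊤ := by
    intro h
    rw [h] at hdel
    exact absurd hdel (by simp)
  obtain ⟨d', hd'⟩ := ENat.ne_top_iff_exists.1 hfin'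
  have hdd' : d = d' + 1 := by
    rw [← hd'] at hdel
    exact_mod_cast hdel.symm
  have hd'enc : (M ＼ {x}).E.encard = (M ＼ {x}).eRank + d' := by
    have h := _root_.Matroid.eRank_add_eRank_dual (M ＼ {x})
    rw [← hd'] at h
    exact h.symm
  have hdelE : (M ＼ {x}).E.ncard < n := by
    rw [_root_.Matroid.delete_ground, ← hn, ← ncard_sdiff_singleton_add_one heE M.ground_finite]
    omega
  have hC1' : ∀ L ⊆ (M ＼ {x}).E, (M ＼ {x}).eRk L = 2 → L.ncard ≤ 3 := by
    intro L hL hr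
    rw [_root_.Matroid.delete_ground] at hL
    rw [delete_singleton_eRk_eq hL] at hr
    exact hC1 L (hL.trans sdiff_subset) hr
  -- (a) `s₃ ≤ m + triBound d'`
  set S₁ := ThmN.trianglesThrough M x with hS₁
  set S₂ := {C | M.IsCircuit C ∧ C.ncard = 3 ∧ x ∉ C} with hS₂
  have hsplit : S ⊆ S₁ ∪ S₂ := by
    intro C hC
    by_cases h : x ∈ C
    · exact Or.inl ⟨hC.1, hC.2, h⟩
    · exact Or.inr ⟨hC.1, hC.2, h⟩
  have hS₁fin : S₁.Finite := hSfin.subset (fun C hC => ⟨hC.1, hC.2.1⟩)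
  have hS₂fin : S₂.Finite := hSfin.subset (fun C hC => ⟨hC.1, hC.2.1⟩)
  have h3 : S.ncard ≤ S₁.ncard + S₂.ncard :=
    (ncard_le_ncard hsplit (hS₁fin.union hS₂fin)).trans (ncard_union_le _ _)
  have hsub : S₂ ⊆ ThmN.triangles (M ＼ {x}) := by
    intro C hC
    exact ⟨_root_.Matroid.delete_isCircuit_iff.2 ⟨hC.1, disjoint_singleton_right.2 hC.2.2⟩, hC.2.1⟩
  have hS₂ : S₂.ncard ≤ triBound d' :=
    (ncard_le_ncard hsub
      ((M ＼ {x}).ground_finite.finite_subsets.subset (fun C hC => hC.1.subset_ground))).trans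
      (ih _ hdelE (M ＼ {x}) rfl hC1' d' hd'enc)
  have ha : S.ncard ≤ m + triBound d' := by omega
  -- (b) `m(2m + 1) ≤ 3·s₃`
  have hstar := one_add_two_mul_ncard_trianglesThrough_le M hC1 hx hxU'
  have hdc := ncard_sUnion_mul_le_three_mul_ncard_triangles M hmin
  have hb : m + 2 * m * m ≤ 3 * S.ncard := by
    have h1 : (1 + 2 * m) * m ≤ (⋃₀ ThmN.triangles M).ncard * m := Nat.mul_le_mul_right m hstar
    have h2 : (1 + 2 * m) * m = m + 2 * m * m := by ring
    rw [h2] at h1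
    exact h1.trans hdc
  -- (c) `m ≤ tmax (triBound d')`
  have hc : 2 * m * m ≤ 2 * m + 3 * triBound d' := by
    have h1 : 3 * S.ncard ≤ 3 * m + 3 * triBound d' := by omega
    omega
  have hmt : m ≤ tmax (triBound d') := le_tmax_of_le hc
  have hrec := triBound_succ d'
  subst hdd'
  omega

end S1

end PercRepro
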